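import Mathlib
import Literature.MathematicalPhysics.QuantumFieldTheory.Balaban1983to89.B9Eq320Gauss
import Literature.MathematicalPhysics.QuantumFieldTheory.Balaban1983to89.B9Thm311Lattice

/-! # `Balaban1983to89.B9Eq320Z0` — B9 (3.17)/(3.20): the normalisation Z0 = ∫dλ δ(Q′λ) exp(−(1/2α)‖Δ^η_U λ‖²) is
POSITIVE (pass 8's one named hypothesis `Z0 ≠ 0` proved), and (3.20) on the lattice system, kernel-checked

CITATION HEADER.  Paper sub-cell `b2b-balaban-b09` (gen 6, journal claim SHARPEN T06.1 (3.17)/(3.20) normalisation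
Z0 > 0 pass 13 ∕ C-B9-34-Z0, cell pub-balaban) on T. Balaban, *Propagators for lattice gauge theories in a background
field*, Commun. Math. Phys. 99 (1985) 389–434 [`Balaban1985BackgroundPropagators`] (= B9), pp. 393–394 [PDF 5–6],
with [3] = *Propagators and renormalization transformations … I*, Commun. Math. Phys. 95 (1984) 17–40
[`Balaban1984PropagatorsI`] (= B5), pp. 24–25 [PDF 8–9] (renders `b2b-balaban-ref1/pages/1985-cmp99-background-
propagators/…-p005-x2.png`, `…-p006-x2.png`, `…/1984-cmp95-propagators-rt-I/…-p008-x2.png`, `…-p009-x2.png`, read as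
images in passes 8–12 of this lineage).

WHAT IS PRINTED (verbatim).
* B9 p. 393, (3.17): *"We define a gauge fixing density by the expression exp(−(1/2α)‖D\*A‖²)(Z′^{−1}∫dλ δ(Q′λ)
  exp(−(1/2α)‖D\*A^λ‖²))^{−1}, (3.17)"*; p. 394: *"The integral in (3.17) can be calculated in the same way as in [3],
  (1.42)–(1.44), and we get (3.17) = exp(−(1/2α)‖RD\*A‖²), (3.20)"*.
* B5 p. 24, (1.39): *"𝒢_α(∂\*A) = (∫dλ δ(Q′_kλ) exp(−(1/2α)‖Δλ‖²))^{−1} exp(−(1/2α)‖R∂\*A‖²)"*; p. 25, (1.40): *"∫dλ δ(Q′_kλ)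
  exp(−(1/2α)‖Δλ‖²) = ∫_{N(Q′_k)} dλ exp(−(1/2α)‖Δλ‖²) = …"*.

WHY THIS FILE.  Pass 8 (`B9Eq320Gauss`, C-B9-29) certified "(3.17) = exp(−(1/2α)‖RD\*A‖²), (3.20)" under the `Data` of
pass 6 and ONE named non-degeneracy hypothesis: `Z0 Δ ι μ α ≠ 0`, where `Z0` = ∫ exp(−(1/2α)‖Δ^η_U ιw‖²) dμ(w) is B5's
prefactor integral (1.39)/(1.40) (B9 writes Z′^{−1}, presupposing it).  With Mathlib's Bochner integral Z0 = 0 exactly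
when the Gaussian is not integrable or μ = 0.  THIS FILE proves `0 < Z0` in the printed reading of (1.40) — the
parameter space W = N(Q′) a finite-dimensional real inner-product space with its Lebesgue measure (`volume`), α > 0,
and Δ^η_U injective on N(Q′) — and then discharges EVERYTHING on the lattice system of pass 12 (`B9Thm311Lattice`):
W := ker Q′ = `LinearMap.ker qL`, ι := the inclusion, injectivity of Δ^η_U on N(Q′) from `lapL_qL_kernel` (pass 10),
the `Data` from `obvious_311_lattice` (pass 12); so (3.20) holds on every finite lattice system with Z′ = Z0 > 0 and
R = the orthogonal projection onto Δ^η_U N(Q′) — no hypothesis left except α > 0, positive weights, injective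
transports and the structural block facts.  [folklore]; value = kernel-checked bookkeeping, NOT summit progress.

WHAT THIS FILE CERTIFIES (kernel, zero sorry).
1. `exists_norm_le_of_injective` — an injective linear map T on a finite-dimensional space is bounded below:
   ‖w‖ ≤ C‖Tw‖ (norm of the inverse on the range).
2. `integrable_gauss_of_injective` — for α > 0, w ↦ exp(−(1/2α)‖Tw‖²) is Lebesgue-integrable on W (domination by
   exp(−b‖w‖²), b = 1/(2α(C²+1)), whose integral Mathlib knows: `GaussianFourier.integral_rexp_neg_mul_sq_norm`).
3. `Z0_pos` — **0 < Z0 Δ ι volume α** for α > 0 and Δ∘ι injective (`integral_exp_pos`).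
4. Lattice: `lapL_ker_injective` (Δ^η_U is injective on N(Q′)), `Z0_lattice_pos`, and `density_320_lattice` — on the
   system of pass 12, (3.17) with Z′ = Z0 equals exp(−(1/2α)‖Rf‖²) with R = the orthogonal projection `starProjection`
   onto the (3.21) subspace (`B9Eq325Proj.lapKer`), for every f = D\*A.
NOT here: Balaban's weights in the measure dλ (any Haar normalisation only rescales Z0 = Z′), infinite lattices, bounds.
Cell records: GAPS C-B9-34, DIVERGENCE D-b09.25. -/

namespace Literature.MathematicalPhysics.QuantumFieldTheory.Balaban1983to89.B9Eq320Z0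

open MeasureTheory B9Eq325Proj B9Thm311Data B9Eq320Gauss B9Thm311Lattice
open scoped InnerProductSpace

/-! ## §1  Z0 > 0 for a non-degenerate Gaussian on a finite-dimensional parameter space -/

section Abstract

variable {E W : Type*} [NormedAddCommGroup E] [InnerProductSpace ℝ E] [NormedAddCommGroup W]
  [InnerProductSpace ℝ W] [FiniteDimensional ℝ W]

/-- An injective linear map on a finite-dimensional space is bounded below. [folklore] -/
theorem exists_norm_le_of_injective (T : W →ₗ[ℝ] E) (hT : Function.Injective T) :
    ∃ C : ℝ, 0 ≤ C ∧ ∀ w : W, ‖w‖ ≤ C * ‖T w‖ := by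
  let e := (LinearEquiv.ofInjective T hT).toContinuousLinearEquiv
  refine ⟨‖(e.symm : LinearMap.range T →L[ℝ] W)‖, ContinuousLinearMap.opNorm_nonneg _, fun w => ?_⟩
  have h1 : ‖(e w : LinearMap.range T)‖ = ‖T w‖ := rfl
  calc ‖w‖ = ‖(e.symm : LinearMap.range T →L[ℝ] W) (e w)‖ := by
        rw [ContinuousLinearEquiv.coe_coe, ContinuousLinearEquiv.symm_apply_apply]
    _ ≤ ‖(e.symm : LinearMap.range T →L[ℝ] W)‖ * ‖e w‖ := ContinuousLinearMap.le_opNorm _ _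
    _ = ‖(e.symm : LinearMap.range T →L[ℝ] W)‖ * ‖T w‖ := by rw [h1]

variable [MeasurableSpace W] [BorelSpace W]

/-- For α > 0 and T injective, w ↦ exp(−(1/2α)‖Tw‖²) is Lebesgue-integrable on W. [folklore] -/
theorem integrable_gauss_of_injective {α : ℝ} (hα : 0 < α) (T : W →ₗ[ℝ] E) (hT : Function.Injective T) :
    Integrable (fun w : W => Real.exp (-(1 / (2 * α)) * ‖T w‖ ^ 2)) := by
  obtain ⟨C, hC0, hC⟩ := exists_norm_le_of_injective T hT
  set b : ℝ := 1 / (2 * α * (C ^ 2 + 1)) with hb_def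
  have hb : 0 < b := by positivity
  have hint : Integrable (fun w : W => Real.exp (-b * ‖w‖ ^ 2)) := by
    apply Integrable.of_integral_ne_zero
    rw [GaussianFourier.integral_rexp_neg_mul_sq_norm hb]
    positivity
  refine hint.mono' ?_ (Filter.Eventually.of_forall fun w => ?_)
  · have hc : Continuous fun w : W => Real.exp (-(1 / (2 * α)) * ‖T w‖ ^ 2) :=
      Real.continuous_exp.comp (continuous_const.mul ((T.continuous_of_finiteDimensional.norm).pow 2))
    exact hc.aestronglyMeasurable
  · rw [Real.norm_eq_abs, abs_of_pos (Real.exp_pos _), Real.exp_le_exp]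
    have h1 : ‖w‖ ^ 2 ≤ (C ^ 2 + 1) * ‖T w‖ ^ 2 := by
      have h0 : ‖w‖ ^ 2 ≤ (C * ‖T w‖) ^ 2 := pow_le_pow_left₀ (norm_nonneg _) (hC w) 2
      nlinarith [sq_nonneg ‖T w‖]
    have hne : (C ^ 2 + 1) ≠ 0 := by positivity
    have h2 : b * ((C ^ 2 + 1) * ‖T w‖ ^ 2) = 1 / (2 * α) * ‖T w‖ ^ 2 := by
      rw [hb_def]
      field_simp
    have h3 : b * ‖w‖ ^ 2 ≤ 1 / (2 * α) * ‖T w‖ ^ 2 :=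
      (mul_le_mul_of_nonneg_left h1 hb.le).trans_eq h2
    linarith

/-- **Z0 > 0**: the prefactor integral ∫dλ δ(Q′λ) exp(−(1/2α)‖Δ^η_U λ‖²) of B5 (1.39)/(1.40), typed as pass 8's `Z0` with
the Lebesgue measure of the parameter space, is positive when α > 0 and Δ^η_U ι is injective.
[cite: Balaban1984PropagatorsI, (1.39)-(1.40) p.24-25; Balaban1985BackgroundPropagators, (3.17) p.393] -/
theorem Z0_pos {α : ℝ} (hα : 0 < α) (Δ : E →ₗ[ℝ] E) (ι : W →ₗ[ℝ] E) (hinj : Function.Injective (Δ ∘ₗ ι)) :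
    0 < Z0 Δ ι volume α := by
  rw [Z0_eq]
  have hint := integrable_gauss_of_injective hα (Δ ∘ₗ ι) hinj
  simp only [LinearMap.coe_comp, Function.comp_apply] at hint
  exact integral_exp_pos hint

/-- Hence Z0 ≠ 0, the hypothesis of pass 8's `density_320`, `fp_normalisation'`, …. [folklore] -/
theorem Z0_ne_zero {α : ℝ} (hα : 0 < α) (Δ : E →ₗ[ℝ] E) (ι : W →ₗ[ℝ] E) (hinj : Function.Injective (Δ ∘ₗ ι)) :
    Z0 Δ ι volume α ≠ 0 :=
  (Z0_pos hα Δ ι hinj).ne'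

end Abstract

/-! ## §2  On the lattice system of `B9Thm311Lattice` -/

section Lattice

variable {X : Type*} {Y : Type*} {V : Type*} [Fintype X] [NormedAddCommGroup V] [InnerProductSpace ℝ V]
  [FiniteDimensional ℝ V]

/-- Δ^η_U is injective on N(Q′) = ker Q′ (pass 10's kernel lemma: Δλ = 0 ⇒ ⟨λ,Δλ⟩ = 0, and Q′λ = 0).
[cite: Balaban1985BackgroundPropagators, (3.21)-(3.23) p.394] -/
theorem lapL_ker_injective (τ : X → X → V →ₗ[ℝ] V) (hinj : ∀ x x' : X, Function.Injective (τ x x'))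
    {bonds : Finset (X × X)} (cb : X × X → ℝ) (hcb : ∀ b ∈ bonds, 0 < cb b) {w : Y → X → ℝ}
    {B : Y → Finset X} {Γ : Y → X → List X} {y : Y → X} (hS : IsBlockSystem bonds w B Γ y) :
    Function.Injective (lapL τ bonds cb ∘ₗ (LinearMap.ker (qL τ w B Γ y)).subtype) := by
  intro u v h
  apply Subtype.ext
  rw [← sub_eq_zero]
  have hq : qL τ w B Γ y ((u : PiLp 2 (fun _ : X => V)) - v) = 0 := by
    rw [map_sub, LinearMap.mem_ker.mp u.2, LinearMap.mem_ker.mp v.2, sub_zero]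
  have hl : lapL τ bonds cb ((u : PiLp 2 (fun _ : X => V)) - v) = 0 := by
    rw [map_sub, sub_eq_zero]
    exact h
  refine lapL_qL_kernel τ hinj cb hcb hS _ ?_ hq
  rw [hl, inner_zero_right]

/-- **Z0 > 0 on the lattice system** (W = N(Q′) with its Lebesgue measure, any Borel structure).
[cite: Balaban1984PropagatorsI, (1.40) p.25; Balaban1985BackgroundPropagators, (3.17) p.393] -/
theorem Z0_lattice_pos (τ : X → X → V →ₗ[ℝ] V) (hinj : ∀ x x' : X, Function.Injective (τ x x'))
    {bonds : Finset (X × X)} (cb : X × X → ℝ) (hcb : ∀ b ∈ bonds, 0 < cb b) {w : Y → X → ℝ}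
    {B : Y → Finset X} {Γ : Y → X → List X} {y : Y → X} (hS : IsBlockSystem bonds w B Γ y)
    [MeasurableSpace (LinearMap.ker (qL τ w B Γ y))] [BorelSpace (LinearMap.ker (qL τ w B Γ y))]
    {α : ℝ} (hα : 0 < α) :
    0 < Z0 (lapL τ bonds cb) (LinearMap.ker (qL τ w B Γ y)).subtype volume α :=
  Z0_pos hα _ _ (lapL_ker_injective τ hinj cb hcb hS)

/-- **(3.20) ON THE LATTICE SYSTEM, nothing assumed**: for α > 0, a_c > 0, positive bond weights, injective transports
and a block system with the printed structural facts, the gauge-fixing density (3.17) with Z′ = Z0 (> 0) equals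
exp(−(1/2α)‖Rf‖²), R = the orthogonal projection onto the (3.21) subspace, for EVERY f = D\*A.
[cite: Balaban1985BackgroundPropagators, (3.17) p.393, (3.20)-(3.21) p.394] -/
theorem density_320_lattice [Fintype Y] (τ : X → X → V →ₗ[ℝ] V)
    (hinj : ∀ x x' : X, Function.Injective (τ x x')) {bonds : Finset (X × X)} (cb : X × X → ℝ)
    (hcb : ∀ b ∈ bonds, 0 < cb b) {w : Y → X → ℝ} {B : Y → Finset X} {Γ : Y → X → List X} {y : Y → X}
    (hS : IsBlockSystem bonds w B Γ y) (a : Y → ℝ) (ha : ∀ c, 0 < a c)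
    [MeasurableSpace (LinearMap.ker (qL τ w B Γ y))] [BorelSpace (LinearMap.ker (qL τ w B Γ y))]
    {α : ℝ} (hα : 0 < α) (f : PiLp 2 (fun _ : X => V)) :
    density (lapL τ bonds cb) (LinearMap.ker (qL τ w B Γ y)).subtype volume α
        (Z0 (lapL τ bonds cb) (LinearMap.ker (qL τ w B Γ y)).subtype volume α) f
      = Real.exp (-(1 / (2 * α)) * ‖(lapKer (lapL τ bonds cb) (qL τ w B Γ y)).starProjection f‖ ^ 2) := by
  obtain ⟨g, c, hdata, -, -, -, -, -⟩ := obvious_311_lattice τ hinj cb hcb hS a ha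
  have hι : ∀ u : LinearMap.ker (qL τ w B Γ y), qL τ w B Γ y ((LinearMap.ker (qL τ w B Γ y)).subtype u) = 0 :=
    fun u => LinearMap.mem_ker.mp u.2
  have hι' : ∀ l, qL τ w B Γ y l = 0 → ∃ u : LinearMap.ker (qL τ w B Γ y),
      (LinearMap.ker (qL τ w B Γ y)).subtype u = l :=
    fun l hl => ⟨⟨l, LinearMap.mem_ker.mpr hl⟩, rfl⟩
  rw [density_320 hdata hι hι' volume α (Z0_lattice_pos τ hinj cb hcb hS hα).ne' f,
    proj_of_any_data hdata f]

end Lattice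

end Literature.MathematicalPhysics.QuantumFieldTheory.Balaban1983to89.B9Eq320Z0
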